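import Summits.QuantumFields.BalabanUV.Beta.D1BFx.LatticeHLSRadial
import Literature.MathematicalPhysics.QuantumFieldTheory.Balaban1983to89.Beta.AxialProjector
import Literature.MathematicalPhysics.QuantumFieldTheory.Balaban1983to89.B6QGQLower276

/-!
# `BalabanUV.Beta.D1BFx.BlockPairRieszCount` — road «BF-x» for binder row D1, slot (K): **THE BLOCK-PAIR RIESZ COUNT
# `Σ_{x ∈ B_y} Σ_{x′ ∈ B_{y′}} nrm(x′ − x)^{−p}` ON `ℤ^d` AT BLOCK SIDE `n`** — sub-critical `p ≤ d−1`: `≤ C_d·n^{2d−p}` for EVERY pair of blocks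
# (near ∕ edge classes by a window of radius `2n−1` per first vertex; far classes `‖y′−y‖∞ ≥ 2` with the decay `(n‖y′−y‖∞)^{−p}`), critical `p = d`:
# `≤ n^d·(1 + C_d(1 + log(2n−1)))`; the `d = 4` readings `p = 3 ↦ 433·n⁵`, `p = 2 ↦ 865·n⁶`, `p = 4 ↦ n⁴·(1 + 216·(1 + log(2n−1)))`.

WHY (OWNER d1-p2 g23 `PART24-SPEC-g23.md` c08ae833fffd2503 §2, R-BB ∕ R-AB: «the lattice count `Σ_{x∈B₀,x′∈B_z} nrm⁻³ ≤ C·n⁵` (edge∕generic classes) as a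
stand-alone [folklore] lemma»; this lineage's N2 «TOWER-WEIGHT CENSUS» v1.2 §3–§4 (d1): the same counts price the ghost rest words at the tower weight —
two bare legs between two lattice-local vertices = the critical `p = 4` log, one smooth factor = sub-critical).  A one-file corollary of the g9 «GN-L5 HLS KIT»
(`LatticeHLSRadial.sum_inv_nrm_pow_le` ∕ `sum_inv_nrm_pow_crit_le`), in the road's block convention `B_y = {n•y + toSite b : b ∈ box d n}`
(`AffineAveraging.box ∕ toSite`, `AxialProjector.toSite_injective`, as in `PackedColumnBlockTotalMass`) and the kit's `nrm = max(1, ‖·‖∞)` currency (`PoissonInterior.nrm`).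

CONTENT (all [folklore]; `d ≥ 1`, `n ≥ 1`):
* §1 sup-norm plumbing: `card_box_cast`, `supNorm_toSite_sub_le` (`‖toSite b′ − toSite b‖∞ ≤ n−1` on the box), `supNorm_zsmul_le` ∕ `le_supNorm_zsmul`
  (`‖n•z‖∞ = n‖z‖∞`, the two inequalities), `supNorm_blockDisp_le` ∕ `le_supNorm_blockDisp` (`n‖z‖∞ − (n−1) ≤ ‖n•z + toSite b′ − toSite b‖∞ ≤ n‖z‖∞ + (n−1)`).
* §2 NEAR ∕ EDGE classes `‖y′ − y‖∞ ≤ 1`: one vertex `sum_box_inv_nrm_pow_near_le` (`≤ 1 + 2d·3^{d−1}·(2n−1)^{d−p}`), both vertices `sum_box_box_inv_nrm_pow_near_le`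
  (`≤ n^d·(…)`), critical twins `…_crit_near_le` (`(2n−1)^{d−p} ↦ 1 + log(2n−1)`).
* §3 FAR classes `2 ≤ ‖y′ − y‖∞`: pointwise `inv_nrm_pow_blockDisp_far_le` (`nrm^{−p} ≤ 2^p·(n‖y′−y‖∞)^{−p}`), both vertices `sum_box_box_inv_nrm_pow_far_le`
  (`≤ n^{2d}·2^p·(n‖y′−y‖∞)^{−p}`) — any `p`.
* §4 the `d = 4` readings, uniform in the pair of blocks: `sum_box_box_inv_nrm_cube_le_d4` (`p = 3`: `≤ 433·n⁵`), `sum_box_box_inv_nrm_sq_le_d4` (`p = 2`: `≤ 865·n⁶`),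
  `sum_box_box_inv_nrm_four_le_d4` (`p = 4`: `≤ n⁴·(1 + 216·(1 + log(2n−1)))` near, `≤ n⁴` far).
* §5 the leg files' spelling `B6QGQLower276.B n y`: `B_eq_image_box`, `sum_B_sum_B_eq_sum_box` (transport of every §2–§4 count), `sum_B_sum_B_inv_nrm_cube_le_d4`.

HONEST DEPENDENCY (cell records, verbatim): «continuum YM on T⁴ ⇐ BetaPertH ∧ nine spine estimates (0/9 proved); BetaPertH ⇐ (D1) ∧ (D4) ∧
CAP+tail; G-an2-4 gates asym, D1 and NE2/3/4.»  HONEST FRAMING (cell contract, verbatim): «discharging `BetaPertH` makes Bałaban's UV stability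
UNCONDITIONAL — a real constructive-QFT result; it is NOT the continuum limit and NOT the Clay problem.»  THIS MODULE DISCHARGES NOTHING of (K), of
D1 or of the wall: [folklore] lattice counting over OUR block convention; no road object, no estimate of any kernel, nothing of Bałaban's asserted.  No definition,
no `def … : Prop`, nothing cited, 0 sorry.  0 root-level binders of row D1 discharged; (K) NOT closed; NOT D1, NOT `BetaPertH`, NOT continuum, NOT Clay.
ABSOLUTE RULE (cell charter, verbatim): «No internally-minted statement may enter as a cited fact. Every hypothesis is either kernel-proved in this
package or a verbatim quotation of a PUBLISHED theorem with page reference. The manuscript(s) under audit are NOT citable for their own disputed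
steps — they are the thing under adjudication; programme-internal (2001/route/tribunal) claims are never citable.»
Unit `b2b-balaban-beta-d1-formalise-leaf-04` (gen 25), D1 formalisation swarm leaf prover 04, road «BF-x» (journal [D1LEAF04-G25-*]).
-/

noncomputable section

namespace Summit.QuantumFields.BalabanUV.Beta.D1BFx.BlockPairRieszCount

open Finset Real
open Literature.Probability.LatticeModels (Site)
open Literature.MathematicalPhysics.QuantumFieldTheory.Balaban1983to89
open Literature.MathematicalPhysics.QuantumFieldTheory.Balaban1983to89.Beta
open PoissonInterior (supNorm nrm supNorm_le_iff natAbs_le_supNorm supNorm_add_le supNorm_sub_le supNorm_neg exists_natAbs_eq_supNorm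
  nrm_pos one_le_nrm supNorm_le_nrm inv_nrm_pow_le)
open AffineAveraging (box toSite)
open AxialProjector (toSite_injective)
open Summit.QuantumFields.BalabanUV.Beta.D1BFx.LatticeHLSRadial (sum_inv_nrm_pow_le sum_inv_nrm_pow_crit_le)

variable {d : ℕ}

/-! ## §1 Sup-norm plumbing for the block convention `B_y = {n•y + toSite b : b ∈ box d n}` -/

/-- [folklore] `#box d n = n^d`, as a real number (the form the block sums below consume). -/
theorem card_box_cast (d n : ℕ) : ((box d n).card : ℝ) = (n : ℝ) ^ d := by
  have h : (box d n).card = n ^ d := by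
    simp [AffineAveraging.box, Fintype.card_piFinset, Finset.card_range, Finset.prod_const, Finset.card_univ, Fintype.card_fin]
  rw [h]; push_cast; rfl

/-- [folklore] A coordinate of a box offset is `< n`. -/
theorem lt_of_mem_box {n : ℕ} {b : Fin d → ℕ} (hb : b ∈ box d n) (i : Fin d) : b i < n := by
  have hb' : b ∈ Fintype.piFinset fun _ : Fin d => Finset.range n := hb
  exact Finset.mem_range.mp (Fintype.mem_piFinset.mp hb' i)

/-- [folklore] **TWO OFFSETS OF ONE BOX ARE `≤ n−1` APART** in every coordinate: `‖toSite b′ − toSite b‖∞ ≤ n − 1`. -/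
theorem supNorm_toSite_sub_le {n : ℕ} {b b' : Fin d → ℕ} (hb : b ∈ box d n) (hb' : b' ∈ box d n) :
    supNorm (toSite b' - toSite b) ≤ n - 1 := by
  rw [supNorm_le_iff]
  intro i
  have h1 := lt_of_mem_box hb i
  have h2 := lt_of_mem_box hb' i
  simp only [Pi.sub_apply, AffineAveraging.toSite]
  omega

/-- [folklore] `‖n•z‖∞ ≤ n·‖z‖∞`. -/
theorem supNorm_zsmul_le (n : ℕ) (z : Site d) : supNorm ((n : ℤ) • z) ≤ n * supNorm z := by
  rw [supNorm_le_iff]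
  intro i
  rw [Pi.smul_apply, smul_eq_mul, Int.natAbs_mul, Int.natAbs_natCast]
  exact Nat.mul_le_mul_left n (natAbs_le_supNorm z i)

/-- [folklore] `n·‖z‖∞ ≤ ‖n•z‖∞` (so `=`; `d ≥ 1`). -/
theorem le_supNorm_zsmul (hd : 0 < d) (n : ℕ) (z : Site d) : n * supNorm z ≤ supNorm ((n : ℤ) • z) := by
  obtain ⟨i, hi⟩ := exists_natAbs_eq_supNorm hd z
  have h := natAbs_le_supNorm ((n : ℤ) • z) i
  rw [Pi.smul_apply, smul_eq_mul, Int.natAbs_mul, Int.natAbs_natCast, hi] at h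
  exact h

/-- [folklore] **UPPER WINDOW**: `‖n•z + toSite b′ − toSite b‖∞ ≤ n‖z‖∞ + (n−1)` on the box. -/
theorem supNorm_blockDisp_le {n : ℕ} (z : Site d) {b b' : Fin d → ℕ} (hb : b ∈ box d n) (hb' : b' ∈ box d n) :
    supNorm ((n : ℤ) • z + toSite b' - toSite b) ≤ n * supNorm z + (n - 1) := by
  rw [add_sub_assoc]
  exact (supNorm_add_le _ _).trans (Nat.add_le_add (supNorm_zsmul_le n z) (supNorm_toSite_sub_le hb hb'))

/-- [folklore] **LOWER WINDOW**: `n‖z‖∞ ≤ ‖n•z + toSite b′ − toSite b‖∞ + (n−1)` on the box (`d ≥ 1`). -/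
theorem le_supNorm_blockDisp (hd : 0 < d) {n : ℕ} (z : Site d) {b b' : Fin d → ℕ} (hb : b ∈ box d n) (hb' : b' ∈ box d n) :
    n * supNorm z ≤ supNorm ((n : ℤ) • z + toSite b' - toSite b) + (n - 1) := by
  have h1 := le_supNorm_zsmul hd n z
  -- `‖n•z‖ ≤ ‖n•z + t‖ + ‖t‖` with `t = toSite b′ − toSite b`
  have h2 := supNorm_sub_le ((n : ℤ) • z) (-(toSite b' - toSite b))
  rw [sub_neg_eq_add, supNorm_neg] at h2
  have h3 := supNorm_toSite_sub_le hb hb'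
  rw [add_sub_assoc]
  omega

/-- [folklore] The displacement between a point of `B_y` and a point of `B_{y′}` is `n•(y′−y) + toSite b′ − toSite b`. -/
theorem blockDisp_eq (n : ℕ) (y y' : Site d) (b b' : Fin d → ℕ) :
    ((n : ℤ) • y' + toSite b') - ((n : ℤ) • y + toSite b) = (n : ℤ) • (y' - y) + toSite b' - toSite b := by
  rw [smul_sub]; abel

/-! ## §2 Near ∕ edge classes `‖y′ − y‖∞ ≤ 1`: a window of radius `2n − 1` around each first vertex -/

section Near

variable (hd : 0 < d) {n : ℕ} (hn : 1 ≤ n) {y y' : Site d} (hz : supNorm (y' - y) ≤ 1)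
include hd hn hz

/-- [folklore] **ONE VERTEX, NEAR CLASS, SUB-CRITICAL** `p ≤ d−1`: for a fixed `x = n•y + toSite b ∈ B_y`,
`Σ_{b′ ∈ box} nrm((n•y′ + toSite b′) − x)^{−p} ≤ 1 + 2d·3^{d−1}·(2n−1)^{d−p}` (window `R = 2n−1`: `‖n•(y′−y)‖∞ ≤ n`, in-box offsets `≤ n−1`). -/
theorem sum_box_inv_nrm_pow_near_le {p : ℕ} (hp : p ≤ d - 1) {b : Fin d → ℕ} (hb : b ∈ box d n) :
    ∑ b' ∈ box d n, 1 / nrm (((n : ℤ) • y' + toSite b') - ((n : ℤ) • y + toSite b)) ^ p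
      ≤ 1 + 2 * d * 3 ^ (d - 1) * ((2 * n - 1 : ℕ) : ℝ) ^ (d - p) := by
  classical
  have hinj : ∀ b₁ ∈ box d n, ∀ b₂ ∈ box d n, (n : ℤ) • y' + toSite b₁ = (n : ℤ) • y' + toSite b₂ → b₁ = b₂ :=
    fun b₁ _ b₂ _ h => toSite_injective (add_left_cancel h)
  have e : ∑ b' ∈ box d n, 1 / nrm (((n : ℤ) • y' + toSite b') - ((n : ℤ) • y + toSite b)) ^ p
      = ∑ x ∈ (box d n).image (fun b' => (n : ℤ) • y' + toSite b'), 1 / nrm (x - ((n : ℤ) • y + toSite b)) ^ p := by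
    rw [Finset.sum_image hinj]
  rw [e]
  refine sum_inv_nrm_pow_le hd hp _ _ (R := 2 * n - 1) fun x hx => ?_
  obtain ⟨b', hb', rfl⟩ := Finset.mem_image.mp hx
  rw [blockDisp_eq]
  have h := supNorm_blockDisp_le (y' - y) hb hb'
  have h' : n * supNorm (y' - y) ≤ n * 1 := Nat.mul_le_mul_left n hz
  omega

/-- [folklore] **ONE VERTEX, NEAR CLASS, CRITICAL** `p = d`: `Σ_{b′ ∈ box} nrm(…)^{−d} ≤ 1 + 2d·3^{d−1}·(1 + log(2n−1))`. -/
theorem sum_box_inv_nrm_pow_crit_near_le {b : Fin d → ℕ} (hb : b ∈ box d n) :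
    ∑ b' ∈ box d n, 1 / nrm (((n : ℤ) • y' + toSite b') - ((n : ℤ) • y + toSite b)) ^ d
      ≤ 1 + 2 * d * 3 ^ (d - 1) * (1 + Real.log ((2 * n - 1 : ℕ) : ℝ)) := by
  classical
  have hinj : ∀ b₁ ∈ box d n, ∀ b₂ ∈ box d n, (n : ℤ) • y' + toSite b₁ = (n : ℤ) • y' + toSite b₂ → b₁ = b₂ :=
    fun b₁ _ b₂ _ h => toSite_injective (add_left_cancel h)
  have e : ∑ b' ∈ box d n, 1 / nrm (((n : ℤ) • y' + toSite b') - ((n : ℤ) • y + toSite b)) ^ d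
      = ∑ x ∈ (box d n).image (fun b' => (n : ℤ) • y' + toSite b'), 1 / nrm (x - ((n : ℤ) • y + toSite b)) ^ d := by
    rw [Finset.sum_image hinj]
  rw [e]
  refine sum_inv_nrm_pow_crit_le hd _ _ (R := 2 * n - 1) fun x hx => ?_
  obtain ⟨b', hb', rfl⟩ := Finset.mem_image.mp hx
  rw [blockDisp_eq]
  have h := supNorm_blockDisp_le (y' - y) hb hb'
  have h' : n * supNorm (y' - y) ≤ n * 1 := Nat.mul_le_mul_left n hz
  omega

/-- [folklore] **BOTH VERTICES, NEAR CLASS, SUB-CRITICAL**: `Σ_{b ∈ box} Σ_{b′ ∈ box} nrm((n•y′ + toSite b′) − (n•y + toSite b))^{−p} ≤ n^d·(1 + 2d·3^{d−1}·(2n−1)^{d−p})`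
(`= C_d·n^{2d−p}` in order; at `d = 4`, `p = 3`: the spec's `C·n⁵`). -/
theorem sum_box_box_inv_nrm_pow_near_le {p : ℕ} (hp : p ≤ d - 1) :
    ∑ b ∈ box d n, ∑ b' ∈ box d n, 1 / nrm (((n : ℤ) • y' + toSite b') - ((n : ℤ) • y + toSite b)) ^ p
      ≤ (n : ℝ) ^ d * (1 + 2 * d * 3 ^ (d - 1) * ((2 * n - 1 : ℕ) : ℝ) ^ (d - p)) := by
  calc ∑ b ∈ box d n, ∑ b' ∈ box d n, 1 / nrm (((n : ℤ) • y' + toSite b') - ((n : ℤ) • y + toSite b)) ^ p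
      ≤ ∑ _b ∈ box d n, (1 + 2 * d * 3 ^ (d - 1) * ((2 * n - 1 : ℕ) : ℝ) ^ (d - p)) :=
        Finset.sum_le_sum fun b hb => sum_box_inv_nrm_pow_near_le hd hn hz hp hb
    _ = _ := by rw [Finset.sum_const, nsmul_eq_mul, card_box_cast]

/-- [folklore] **BOTH VERTICES, NEAR CLASS, CRITICAL** `p = d`: `≤ n^d·(1 + 2d·3^{d−1}·(1 + log(2n−1)))` — the «two bare legs» logarithm. -/
theorem sum_box_box_inv_nrm_pow_crit_near_le :
    ∑ b ∈ box d n, ∑ b' ∈ box d n, 1 / nrm (((n : ℤ) • y' + toSite b') - ((n : ℤ) • y + toSite b)) ^ d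
      ≤ (n : ℝ) ^ d * (1 + 2 * d * 3 ^ (d - 1) * (1 + Real.log ((2 * n - 1 : ℕ) : ℝ))) := by
  calc ∑ b ∈ box d n, ∑ b' ∈ box d n, 1 / nrm (((n : ℤ) • y' + toSite b') - ((n : ℤ) • y + toSite b)) ^ d
      ≤ ∑ _b ∈ box d n, (1 + 2 * d * 3 ^ (d - 1) * (1 + Real.log ((2 * n - 1 : ℕ) : ℝ))) :=
        Finset.sum_le_sum fun b hb => sum_box_inv_nrm_pow_crit_near_le hd hn hz hb
    _ = _ := by rw [Finset.sum_const, nsmul_eq_mul, card_box_cast]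

end Near

/-! ## §3 Far classes `2 ≤ ‖y′ − y‖∞`: every pair of points is `≥ n(‖y′−y‖∞ − 1) + 1 ≥ n‖y′−y‖∞∕2` apart -/

section Far

variable (hd : 0 < d) {n : ℕ} (hn : 1 ≤ n) {y y' : Site d} (hz : 2 ≤ supNorm (y' - y))
include hd hn hz

/-- [folklore] **POINTWISE, FAR CLASS**: `nrm((n•y′ + toSite b′) − (n•y + toSite b))^{−p} ≤ 2^p·(n‖y′−y‖∞)^{−p}` for all offsets of the two boxes. -/
theorem inv_nrm_pow_blockDisp_far_le (p : ℕ) {b b' : Fin d → ℕ} (hb : b ∈ box d n) (hb' : b' ∈ box d n) :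
    1 / nrm (((n : ℤ) • y' + toSite b') - ((n : ℤ) • y + toSite b)) ^ p ≤ 2 ^ p / ((n : ℝ) * (supNorm (y' - y) : ℝ)) ^ p := by
  rw [blockDisp_eq]
  have hm1 : 1 ≤ n * supNorm (y' - y) := le_trans hn (Nat.le_mul_of_pos_right n (by omega))
  have hlow : ((n * supNorm (y' - y) : ℕ) : ℝ) ≤ (supNorm ((n : ℤ) • (y' - y) + toSite b' - toSite b) : ℝ) + ((n - 1 : ℕ) : ℝ) := by
    exact_mod_cast le_supNorm_blockDisp hd (y' - y) hb hb'
  have h2n : ((2 * n : ℕ) : ℝ) ≤ ((n * supNorm (y' - y) : ℕ) : ℝ) := by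
    have : 2 * n ≤ n * supNorm (y' - y) := by rw [mul_comm]; exact Nat.mul_le_mul_left n hz
    exact_mod_cast this
  have hn1 : ((n - 1 : ℕ) : ℝ) = (n : ℝ) - 1 := by rw [Nat.cast_sub hn, Nat.cast_one]
  have hs := supNorm_le_nrm ((n : ℤ) • (y' - y) + toSite b' - toSite b)
  rw [hn1] at hlow
  have hhalf : ((n * supNorm (y' - y) : ℕ) : ℝ) / 2 ≤ nrm ((n : ℤ) • (y' - y) + toSite b' - toSite b) := by
    push_cast at hlow h2n ⊢
    linarith
  have h := inv_nrm_pow_le hm1 (p := p) hhalf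
  simpa only [Nat.cast_mul] using h

/-- [folklore] **BOTH VERTICES, FAR CLASS** (any `p`): `Σ_{b} Σ_{b′} nrm(…)^{−p} ≤ n^d·n^d·2^p·(n‖y′−y‖∞)^{−p}` (`= 2^p·n^{2d−p}·‖y′−y‖∞^{−p}`). -/
theorem sum_box_box_inv_nrm_pow_far_le (p : ℕ) :
    ∑ b ∈ box d n, ∑ b' ∈ box d n, 1 / nrm (((n : ℤ) • y' + toSite b') - ((n : ℤ) • y + toSite b)) ^ p
      ≤ (n : ℝ) ^ d * ((n : ℝ) ^ d * (2 ^ p / ((n : ℝ) * (supNorm (y' - y) : ℝ)) ^ p)) := by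
  calc ∑ b ∈ box d n, ∑ b' ∈ box d n, 1 / nrm (((n : ℤ) • y' + toSite b') - ((n : ℤ) • y + toSite b)) ^ p
      ≤ ∑ _b ∈ box d n, ∑ _b' ∈ box d n, 2 ^ p / ((n : ℝ) * (supNorm (y' - y) : ℝ)) ^ p :=
        Finset.sum_le_sum fun b hb => Finset.sum_le_sum fun b' hb' => inv_nrm_pow_blockDisp_far_le hd hn hz p hb hb'
    _ = _ := by rw [Finset.sum_const, nsmul_eq_mul, card_box_cast, Finset.sum_const, nsmul_eq_mul, card_box_cast]

end Far

/-! ## §4 The `d = 4` readings, uniform in the pair of blocks -/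

section D4

variable {n : ℕ} (hn : 1 ≤ n) (y y' : Site 4)
include hn

/-- [folklore] **`p = 3` (one Coulomb gradient ∕ one gain): `Σ_{x ∈ B_y} Σ_{x′ ∈ B_{y′}} nrm(x′−x)^{−3} ≤ 433·n⁵` FOR EVERY PAIR OF BLOCKS** — the spec's
`C·n⁵` (near: `n⁴·(1 + 216·(2n−1)) ≤ 433·n⁵`; far: `n⁸·8∕(n‖z‖)³ ≤ n⁵` since `‖z‖ ≥ 2`). -/
theorem sum_box_box_inv_nrm_cube_le_d4 :
    ∑ b ∈ box 4 n, ∑ b' ∈ box 4 n, 1 / nrm (((n : ℤ) • y' + toSite b') - ((n : ℤ) • y + toSite b)) ^ 3 ≤ 433 * (n : ℝ) ^ 5 := by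
  have hd : 0 < 4 := by norm_num
  have hn0 : (1 : ℝ) ≤ n := by exact_mod_cast hn
  have hn' : (0 : ℝ) < n := by linarith
  rcases le_or_gt (supNorm (y' - y)) 1 with hz | hz
  · refine (sum_box_box_inv_nrm_pow_near_le hd hn hz (p := 3) (by norm_num)).trans ?_
    have e : ((2 * n - 1 : ℕ) : ℝ) = 2 * n - 1 := by
      rw [Nat.cast_sub (by omega), Nat.cast_mul]; norm_num
    rw [e]
    norm_num
    nlinarith [pow_nonneg hn'.le 4, pow_nonneg hn'.le 5, mul_le_mul_of_nonneg_left hn0 (pow_nonneg hn'.le 4)]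
  · have hz2 : 2 ≤ supNorm (y' - y) := hz
    refine (sum_box_box_inv_nrm_pow_far_le hd hn hz2 3).trans ?_
    have hs : (2 : ℝ) ≤ (supNorm (y' - y) : ℝ) := by exact_mod_cast hz2
    have hkey : (2 : ℝ) ^ 3 / ((n : ℝ) * (supNorm (y' - y) : ℝ)) ^ 3 ≤ 1 / (n : ℝ) ^ 3 := by
      rw [div_le_div_iff₀ (by positivity) (by positivity), one_mul, mul_pow]
      have : (2 : ℝ) ^ 3 ≤ (supNorm (y' - y) : ℝ) ^ 3 := pow_le_pow_left₀ (by norm_num) hs 3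
      nlinarith [pow_pos hn' 3]
    calc (n : ℝ) ^ 4 * ((n : ℝ) ^ 4 * (2 ^ 3 / ((n : ℝ) * (supNorm (y' - y) : ℝ)) ^ 3))
        ≤ (n : ℝ) ^ 4 * ((n : ℝ) ^ 4 * (1 / (n : ℝ) ^ 3)) := by gcongr
      _ = (n : ℝ) ^ 5 := by field_simp
      _ ≤ 433 * (n : ℝ) ^ 5 := by nlinarith [pow_pos hn' 5]

/-- [folklore] **`p = 2` (two Coulomb values): `Σ_{x ∈ B_y} Σ_{x′ ∈ B_{y′}} nrm(x′−x)^{−2} ≤ 865·n⁶` for every pair of blocks**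
(near: `n⁴·(1 + 216·(2n−1)²) ≤ 865·n⁶`; far: `4n⁶∕‖z‖² ≤ n⁶`). -/
theorem sum_box_box_inv_nrm_sq_le_d4 :
    ∑ b ∈ box 4 n, ∑ b' ∈ box 4 n, 1 / nrm (((n : ℤ) • y' + toSite b') - ((n : ℤ) • y + toSite b)) ^ 2 ≤ 865 * (n : ℝ) ^ 6 := by
  have hd : 0 < 4 := by norm_num
  have hn0 : (1 : ℝ) ≤ n := by exact_mod_cast hn
  have hn' : (0 : ℝ) < n := by linarith
  rcases le_or_gt (supNorm (y' - y)) 1 with hz | hz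
  · refine (sum_box_box_inv_nrm_pow_near_le hd hn hz (p := 2) (by norm_num)).trans ?_
    have e : ((2 * n - 1 : ℕ) : ℝ) = 2 * n - 1 := by
      rw [Nat.cast_sub (by omega), Nat.cast_mul]; norm_num
    rw [e]
    norm_num
    nlinarith [pow_nonneg hn'.le 4, pow_nonneg hn'.le 5, pow_nonneg hn'.le 6, mul_le_mul_of_nonneg_left hn0 (pow_nonneg hn'.le 4),
      mul_le_mul_of_nonneg_left hn0 (pow_nonneg hn'.le 5)]
  · have hz2 : 2 ≤ supNorm (y' - y) := hz
    refine (sum_box_box_inv_nrm_pow_far_le hd hn hz2 2).trans ?_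
    have hs : (2 : ℝ) ≤ (supNorm (y' - y) : ℝ) := by exact_mod_cast hz2
    have hkey : (2 : ℝ) ^ 2 / ((n : ℝ) * (supNorm (y' - y) : ℝ)) ^ 2 ≤ 1 / (n : ℝ) ^ 2 := by
      rw [div_le_div_iff₀ (by positivity) (by positivity), one_mul, mul_pow]
      have : (2 : ℝ) ^ 2 ≤ (supNorm (y' - y) : ℝ) ^ 2 := pow_le_pow_left₀ (by norm_num) hs 2
      nlinarith [pow_pos hn' 2]
    calc (n : ℝ) ^ 4 * ((n : ℝ) ^ 4 * (2 ^ 2 / ((n : ℝ) * (supNorm (y' - y) : ℝ)) ^ 2))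
        ≤ (n : ℝ) ^ 4 * ((n : ℝ) ^ 4 * (1 / (n : ℝ) ^ 2)) := by gcongr
      _ = (n : ℝ) ^ 6 := by field_simp
      _ ≤ 865 * (n : ℝ) ^ 6 := by nlinarith [pow_pos hn' 6]

/-- [folklore] **`p = 4` (CRITICAL — two bare Coulomb gradients ∕ «two bare legs between two lattice-local vertices»):
`Σ_{x ∈ B_y} Σ_{x′ ∈ B_{y′}} nrm(x′−x)^{−4} ≤ n⁴·(1 + 216·(1 + log(2n−1)))` for every pair of blocks** — the logarithm of N2 §3 (near: the critical window;
far: `16n⁴∕‖z‖⁴ ≤ n⁴`). -/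
theorem sum_box_box_inv_nrm_four_le_d4 :
    ∑ b ∈ box 4 n, ∑ b' ∈ box 4 n, 1 / nrm (((n : ℤ) • y' + toSite b') - ((n : ℤ) • y + toSite b)) ^ 4
      ≤ (n : ℝ) ^ 4 * (1 + 216 * (1 + Real.log (2 * (n : ℝ) - 1))) := by
  have hd : 0 < 4 := by norm_num
  have hn0 : (1 : ℝ) ≤ n := by exact_mod_cast hn
  have hn' : (0 : ℝ) < n := by linarith
  have e : ((2 * n - 1 : ℕ) : ℝ) = 2 * n - 1 := by
    rw [Nat.cast_sub (by omega), Nat.cast_mul]; norm_num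
  have hlog : 0 ≤ Real.log (2 * (n : ℝ) - 1) := Real.log_nonneg (by linarith)
  rcases le_or_gt (supNorm (y' - y)) 1 with hz | hz
  · refine (sum_box_box_inv_nrm_pow_crit_near_le hd hn hz).trans ?_
    rw [e]
    norm_num
  · have hz2 : 2 ≤ supNorm (y' - y) := hz
    refine (sum_box_box_inv_nrm_pow_far_le hd hn hz2 4).trans ?_
    have hs : (2 : ℝ) ≤ (supNorm (y' - y) : ℝ) := by exact_mod_cast hz2
    have hkey : (2 : ℝ) ^ 4 / ((n : ℝ) * (supNorm (y' - y) : ℝ)) ^ 4 ≤ 1 / (n : ℝ) ^ 4 := by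
      rw [div_le_div_iff₀ (by positivity) (by positivity), one_mul, mul_pow]
      have : (2 : ℝ) ^ 4 ≤ (supNorm (y' - y) : ℝ) ^ 4 := pow_le_pow_left₀ (by norm_num) hs 4
      nlinarith [pow_pos hn' 4]
    calc (n : ℝ) ^ 4 * ((n : ℝ) ^ 4 * (2 ^ 4 / ((n : ℝ) * (supNorm (y' - y) : ℝ)) ^ 4))
        ≤ (n : ℝ) ^ 4 * ((n : ℝ) ^ 4 * (1 / (n : ℝ) ^ 4)) := by gcongr
      _ = (n : ℝ) ^ 4 * 1 := by field_simp
      _ ≤ (n : ℝ) ^ 4 * (1 + 216 * (1 + Real.log (2 * (n : ℝ) - 1))) := by gcongr; nlinarith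

end D4

/-! ## §5 The leg files' spelling `B6QGQLower276.B n y` (side `n+1`, `blk`-labelled blocks): the same sets, the same sums -/

section BSpelling

open B6QGQLower276 (B chart side)

/-- [folklore] **THE TWO BLOCK SPELLINGS AGREE**: `B n y` (the points with block label `y` at side `n+1`, `GluonLegBlockMass`'s convention) is the image of the
offset box under `b ↦ (n+1)•y + toSite b` (the packed-column files' convention). -/
theorem B_eq_image_box (n : ℕ) (y : Site d) :
    B n y = (box d (n + 1)).image (fun b => ((n + 1 : ℕ) : ℤ) • y + toSite b) := by
  classical
  ext p
  simp only [B, Finset.mem_image]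
  constructor
  · rintro ⟨z, _, rfl⟩
    refine ⟨fun μ => (z μ : ℕ), ?_, ?_⟩
    · exact Fintype.mem_piFinset.mpr fun μ => Finset.mem_range.mpr (z μ).isLt
    · funext μ
      simp only [chart, side, Pi.add_apply, Pi.smul_apply, smul_eq_mul, AffineAveraging.toSite, Nat.cast_add, Nat.cast_one]
  · rintro ⟨b, hb, rfl⟩
    refine ⟨fun μ => ⟨b μ, lt_of_mem_box hb μ⟩, Finset.mem_univ _, ?_⟩
    funext μ
    simp only [chart, side, Pi.add_apply, Pi.smul_apply, smul_eq_mul, AffineAveraging.toSite, Nat.cast_add, Nat.cast_one]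

/-- [folklore] **TRANSPORT OF BLOCK-PAIR SUMS** between the two spellings: for any `f`,
`Σ_{x ∈ B n y} Σ_{x′ ∈ B n y′} f (x′ − x) = Σ_{b ∈ box d (n+1)} Σ_{b′ ∈ box d (n+1)} f (((n+1)•y′ + toSite b′) − ((n+1)•y + toSite b))` — so every count of §2–§4
reads in the `B n y` spelling with side `n+1` (and in the road's `B (n−1) y`, `[NeZero n]`, with side `n`). -/
theorem sum_B_sum_B_eq_sum_box (n : ℕ) (y y' : Site d) (f : Site d → ℝ) :
    ∑ x ∈ B n y, ∑ x' ∈ B n y', f (x' - x)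
      = ∑ b ∈ box d (n + 1), ∑ b' ∈ box d (n + 1), f ((((n + 1 : ℕ) : ℤ) • y' + toSite b') - ((((n + 1 : ℕ) : ℤ) • y + toSite b))) := by
  classical
  have hinj : ∀ (w : Site d), ∀ b₁ ∈ box d (n + 1), ∀ b₂ ∈ box d (n + 1),
      ((n + 1 : ℕ) : ℤ) • w + toSite b₁ = ((n + 1 : ℕ) : ℤ) • w + toSite b₂ → b₁ = b₂ :=
    fun w b₁ _ b₂ _ h => toSite_injective (add_left_cancel h)
  rw [B_eq_image_box, B_eq_image_box, Finset.sum_image (hinj y)]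
  exact Finset.sum_congr rfl fun b _ => by rw [Finset.sum_image (hinj y')]

/-- [folklore] The spec sentence in the leg files' spelling: `Σ_{x ∈ B n y} Σ_{x′ ∈ B n y′} nrm(x′ − x)⁻³ ≤ 433·(n+1)⁵` for every pair of blocks (`d = 4`). -/
theorem sum_B_sum_B_inv_nrm_cube_le_d4 (n : ℕ) (y y' : Site 4) :
    ∑ x ∈ B n y, ∑ x' ∈ B n y', 1 / nrm (x' - x) ^ 3 ≤ 433 * (((n + 1 : ℕ) : ℝ)) ^ 5 := by
  rw [sum_B_sum_B_eq_sum_box n y y' (fun w => 1 / nrm w ^ 3)]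
  exact sum_box_box_inv_nrm_cube_le_d4 (Nat.succ_le_succ (Nat.zero_le n)) y y'

end BSpelling

end Summit.QuantumFields.BalabanUV.Beta.D1BFx.BlockPairRieszCount

end
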